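import Literature.MathematicalPhysics.KineticTheory.LambertianRedrawNondegenerate
import Literature.Analysis.FluidPDE.HardSphereShortTime

/-!
# The Lambertian hard-sphere recursion over a short window: the pre-kick `J`

Helper file (`--supports`) of the support item `LambertianWellPosed` of route `LambertianContactSwap`
(`AtomisticToContinuum/HydrodynamicLimit`, stmt-AtomisticToContinuum-12101). Deterministic (measure-free)
analysis of the Lambertian recursion (`lambertStep`, `lambertStateAfter`, …) over a window `[0, δ]` on a hit
piece of the short-time good set of `Literature.Analysis.FluidPDE.HardSphereShortTime` (`HitHyp ε r δ V z i j`),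
through the **pre-kick**
`J_ξ z = S_{-τ₀} ∘ C_{ij} ∘ L_{ij,ξ} ∘ S_{τ₀} z` (fly to the pair's hitting time `τ₀`, redraw the pair by
`lambertPair` with noise `ξ`, reflect it back elastically, fly back): `J_ξ z` is again a hit-piece datum
(interaction length `2Vδ`, provided `4Vδ ≤ r`), its deterministic first collision produces the Lambertian
post-collisional state `lambertStep ξ z`, and so the Lambertian recursion over the window is the
deterministic flow of `J_ξ z`: truncated forward regularity up to `δ`, `Λ_δ(z; ξs) = Φ_δ(J_{ξs 0} z)`,
exactly one collision. Also: the incoming collision-cylinder coordinates of `billiardGood`, the structure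
of the redrawn relative datum, and the coordinates of `J`.
-/

noncomputable section

open MeasureTheory ProbabilityTheory Set Function Filter Metric
open scoped ENNReal InnerProductSpace Real

namespace Summit.AtomisticToContinuum.HydrodynamicLimit.Theorems

open Literature.MathematicalPhysics.KineticTheory Literature.Analysis.FluidPDE
  Literature.Analysis.FluidPDE.Alexander

namespace LWindow

section Geometry

variable {W : Type*} [NormedAddCommGroup W] [InnerProductSpace ℝ W]

/-- **Incoming cylinder coordinates are billiard-good**: for a unit normal `ν`, a velocity `w` with
`⟪w, ν⟫ < 0` and a flight time `τ > 0`, the relative datum `(ε ν − τ w, w)` lies in `billiardGood ε`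
and its hitting time is `τ` (it reaches the contact point `ε ν` at time `τ`, incoming). [folklore] -/
theorem billiardGood_of_cylinder {ε : ℝ} (hε : 0 < ε) {ν w : W} (hν : ‖ν‖ = 1) (hw : ⟪w, ν⟫_ℝ < 0)
    {τ : ℝ} (hτ : 0 < τ) :
    (ε • ν - τ • w, w) ∈ (billiardGood ε : Set (W × W)) ∧ pairHitTime ε (ε • ν - τ • w) w = τ := by
  have hn : ‖ε • ν‖ = ε := by rw [norm_smul, hν, mul_one, Real.norm_of_nonneg hε.le]
  have hin : ⟪ε • ν, w⟫_ℝ < 0 := by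
    rw [inner_smul_left, real_inner_comm]; exact mul_neg_of_pos_of_neg (by simpa using hε) hw
  have hdisc : pairDisc ε (ε • ν) w = ⟪ε • ν, w⟫_ℝ ^ 2 := by simp [pairDisc, hn]
  have hdisc_pos : 0 < pairDisc ε (ε • ν) w := by rw [hdisc]; nlinarith
  have hhits : PairHits ε (ε • ν) w := ⟨hin, hdisc_pos.le⟩
  have hw0 : w ≠ 0 := fun h => by rw [h, inner_zero_left] at hw; exact lt_irrefl _ hw
  have h0 : pairHitTime ε (ε • ν) w = 0 := (pairHitTime_eq_zero_iff hε.le hhits).2 hn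
  have hτ' : pairHitTime ε (ε • ν + (-τ) • w) w = τ := by
    rw [pairHitTime_add_smul ε _ _ hw0, h0, zero_sub, neg_neg]
  have heq : ε • ν - τ • w = ε • ν + (-τ) • w := by rw [neg_smul, sub_eq_add_neg]
  have hlt : -τ < pairHitTime ε (ε • ν) w := by rw [h0]; linarith
  refine ⟨⟨?_, ?_, ?_⟩, by rw [heq, hτ']⟩
  · rw [heq]; exact lt_norm_add_smul_of_lt_pairHitTime hhits hlt
  · rw [heq]; exact (hhits.add_smul hlt).1
  · show 0 < pairDisc ε (ε • ν - τ • w) w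
    rw [heq, pairDisc_add_smul]; exact hdisc_pos

/-- The hit point of an incoming cylinder datum is `ε ν`. [folklore] -/
theorem hitPoint_of_cylinder {ε : ℝ} (hε : 0 < ε) {ν w : W} (hν : ‖ν‖ = 1) (hw : ⟪w, ν⟫_ℝ < 0)
    {τ : ℝ} (hτ : 0 < τ) : hitPoint ε (ε • ν - τ • w, w) = ε • ν := by
  rw [hitPoint, (billiardGood_of_cylinder hε hν hw hτ).2]
  simp

/-- **Structure of the redrawn relative datum**: for `u ∈ billiardGood ε` and a non-degenerate
Lambertian direction, the redrawn datum `(n − τ₀ u', u')`, `u' = ‖w‖ ρ_n(lambertDir n ξ)`, is again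
billiard-good, with the same hitting time `τ₀`, the same relative speed and the same contact point `n`.
[folklore] -/
theorem redraw_mem_billiardGood {ε : ℝ} (hε : 0 < ε) {u : W × W} (hu : u ∈ (billiardGood ε : Set (W × W)))
    {ξ : W} (hξ : lambertDir (hitPoint ε u) ξ ≠ 0) :
    (hitPoint ε u - pairHitTime ε u.1 u.2 • (‖u.2‖ • (lambertDir (hitPoint ε u) ξ - (2 * ⟪lambertDir (hitPoint ε u) ξ, hitPoint ε u⟫_ℝ / ‖hitPoint ε u‖ ^ 2) • hitPoint ε u)),
        ‖u.2‖ • (lambertDir (hitPoint ε u) ξ - (2 * ⟪lambertDir (hitPoint ε u) ξ, hitPoint ε u⟫_ℝ / ‖hitPoint ε u‖ ^ 2) • hitPoint ε u)) ∈ (billiardGood ε : Set (W × W)) ∧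
      pairHitTime ε (hitPoint ε u - pairHitTime ε u.1 u.2 •
          (‖u.2‖ • (lambertDir (hitPoint ε u) ξ - (2 * ⟪lambertDir (hitPoint ε u) ξ, hitPoint ε u⟫_ℝ / ‖hitPoint ε u‖ ^ 2) • hitPoint ε u)))
        (‖u.2‖ • (lambertDir (hitPoint ε u) ξ - (2 * ⟪lambertDir (hitPoint ε u) ξ, hitPoint ε u⟫_ℝ / ‖hitPoint ε u‖ ^ 2) • hitPoint ε u)) = pairHitTime ε u.1 u.2 ∧
      ‖‖u.2‖ • (lambertDir (hitPoint ε u) ξ - (2 * ⟪lambertDir (hitPoint ε u) ξ, hitPoint ε u⟫_ℝ / ‖hitPoint ε u‖ ^ 2) • hitPoint ε u)‖ = ‖u.2‖ ∧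
      hitPoint ε (hitPoint ε u - pairHitTime ε u.1 u.2 •
          (‖u.2‖ • (lambertDir (hitPoint ε u) ξ - (2 * ⟪lambertDir (hitPoint ε u) ξ, hitPoint ε u⟫_ℝ / ‖hitPoint ε u‖ ^ 2) • hitPoint ε u)),
        ‖u.2‖ • (lambertDir (hitPoint ε u) ξ - (2 * ⟪lambertDir (hitPoint ε u) ξ, hitPoint ε u⟫_ℝ / ‖hitPoint ε u‖ ^ 2) • hitPoint ε u)) = hitPoint ε u := by
  set n := hitPoint ε u with hn
  set τ₀ := pairHitTime ε u.1 u.2 with hτ₀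
  set m := lambertDir n ξ with hm
  set u' := ‖u.2‖ • (m - (2 * ⟪m, n⟫_ℝ / ‖n‖ ^ 2) • n) with hu'
  have hnn : ‖n‖ = ε := norm_hitPoint hε.le hu
  have hn0 : n ≠ 0 := fun h => by rw [h, norm_zero] at hnn; exact hε.ne' hnn.symm
  have hτpos : 0 < τ₀ := pairHitTime_pos hε.le hu.1 (PairHits.of_mem_billiardGood hu)
  have hw : 0 < ‖u.2‖ := (PairHits.of_mem_billiardGood hu).norm_pos
  have hm1 : ‖m‖ = 1 := norm_lambertDir hξ
  have hmn : 0 < ⟪n, m⟫_ℝ := inner_lambertDir_pos hn0 hξ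
  -- the unit normal
  set ν := ε⁻¹ • n with hν
  have hν1 : ‖ν‖ = 1 := by rw [hν, norm_smul, norm_inv, Real.norm_of_nonneg hε.le, hnn, inv_mul_cancel₀ hε.ne']
  have hnν : n = ε • ν := by rw [hν, smul_smul, mul_inv_cancel₀ hε.ne', one_smul]
  -- the redrawn velocity is incoming
  have hin : ⟪u', ν⟫_ℝ < 0 := by
    rw [hu', inner_smul_left, inner_sub_left, inner_smul_left, hν,
      inner_smul_right, inner_smul_right, real_inner_self_eq_norm_sq, hnn, real_inner_comm]
    simp only [RCLike.conj_to_real]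
    have : ε⁻¹ * ⟪n, m⟫_ℝ - 2 * ⟪n, m⟫_ℝ / ε ^ 2 * (ε⁻¹ * ε ^ 2) = -(ε⁻¹ * ⟪n, m⟫_ℝ) := by
      field_simp; ring
    rw [this]
    exact mul_neg_of_pos_of_neg hw (neg_neg_of_pos (mul_pos (inv_pos.2 hε) hmn))
  have key := billiardGood_of_cylinder hε hν1 hin hτpos
  rw [← hnν] at key
  have hnorm : ‖u'‖ = ‖u.2‖ := by
    have hrefl : m - (2 * ⟪m, n⟫_ℝ / ‖n‖ ^ 2) • n = reflN ε n m := by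
      rw [reflN_apply, hnn, real_inner_comm]; ring_nf
    rw [hu', norm_smul, norm_norm, hrefl, norm_reflN hnn hε.ne', hm1, mul_one]
  refine ⟨key.1, key.2, hnorm, ?_⟩
  rw [hitPoint, key.2]
  simp

end Geometry

section JMap

variable {d : Type*} [Fintype d] {N : ℕ} {i j : Fin N} {ε : ℝ}

/-- Coordinates other than the pair are untouched by the Lambertian pre-kick
`J = S_{-τ₀} ∘ C_{ij} ∘ L_{ij,ξ} ∘ S_{τ₀}` (free flight to the pair's hitting time, Lambertian redraw,
elastic reflection backwards, free flight back). [folklore] -/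
theorem lambertKick_apply_of_ne {k : Fin N} (hki : k ≠ i) (hkj : k ≠ j) (τ : ℝ)
    (z : Config N d (UnitAddTorus d)) (ξ : EuclideanSpace ℝ d) :
    freeFlight (Torus.geometry d) (-τ) (collidePair (Torus.geometry d) i j
      (lambertPair (Torus.geometry d) i j (freeFlight (Torus.geometry d) τ z) ξ)) k = z k := by
  rw [freeFlight_apply, collidePair_apply_of_ne hki hkj, lambertPair_apply_of_ne hki hkj, freeFlight_apply]
  refine Prod.ext ?_ rfl
  simp only [Torus.geometry_translate]
  rw [add_assoc, ← Literature.Analysis.FunctionSpaces.Torus.proj_add, neg_smul, add_neg_cancel, Literature.Analysis.FunctionSpaces.Torus.proj_zero, add_zero]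

/-- **The Lambertian pre-kick on the pair**, in the chart: with `q = x_i − x_j` (minimal image),
`w = v_i − v_j`, `τ₀ = pairHitTime ε q w`, `n = q + τ₀ w`, `m = lambertDir n ξ` and the half-impulse
`b = ½ (w − ‖w‖ ρ_n m)`, particle `i` becomes `(x_i + τ₀ b, v_i − b)` and particle `j` becomes
`(x_j − τ₀ b, v_j + b)` (chart condition `‖q‖ + |τ₀| ‖w‖ < 1/2`). [folklore] -/
theorem lambertKick_apply_pair (hij : i ≠ j) (z : Config N d (UnitAddTorus d)) (ξ : EuclideanSpace ℝ d)
    (hch : ‖(Torus.geometry d).sepVec (z i).1 (z j).1‖ +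
      |pairHitTime ε ((Torus.geometry d).sepVec (z i).1 (z j).1) ((z i).2 - (z j).2)| * ‖(z i).2 - (z j).2‖ < 1 / 2) :
    let τ₀ := pairHitTime ε ((Torus.geometry d).sepVec (z i).1 (z j).1) ((z i).2 - (z j).2)
    let n := hitPoint ε ((Torus.geometry d).sepVec (z i).1 (z j).1, (z i).2 - (z j).2)
    let b := (2 : ℝ)⁻¹ • (((z i).2 - (z j).2) - ‖(z i).2 - (z j).2‖ • (lambertDir n ξ - (2 * ⟪lambertDir n ξ, n⟫_ℝ / ‖n‖ ^ 2) • n))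
    freeFlight (Torus.geometry d) (-τ₀) (collidePair (Torus.geometry d) i j
        (lambertPair (Torus.geometry d) i j (freeFlight (Torus.geometry d) τ₀ z) ξ)) i =
      ((z i).1 + Literature.Analysis.FunctionSpaces.Torus.proj (τ₀ • b), (z i).2 - b) ∧
    freeFlight (Torus.geometry d) (-τ₀) (collidePair (Torus.geometry d) i j
        (lambertPair (Torus.geometry d) i j (freeFlight (Torus.geometry d) τ₀ z) ξ)) j =
      ((z j).1 - Literature.Analysis.FunctionSpaces.Torus.proj (τ₀ • b), (z j).2 + b) := by
  intro τ₀ n b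
  set S := freeFlight (Torus.geometry d) τ₀ z with hS
  have hsep : (Torus.geometry d).sepVec (S i).1 (S j).1 = n := by
    rw [hS, sepVec_freeFlight_eq hch]; rfl
  set y := lambertPair (Torus.geometry d) i j S ξ with hy
  have hyi : (y i).1 = (S i).1 := lambertPair_apply_fst S ξ i
  have hyj : (y j).1 = (S j).1 := lambertPair_apply_fst S ξ j
  have hsep' : (Torus.geometry d).sepVec (y i).1 (y j).1 = n := by rw [hyi, hyj, hsep]
  set c : EuclideanSpace ℝ d := (2 : ℝ)⁻¹ • ((z i).2 + (z j).2) with hc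
  set w : EuclideanSpace ℝ d := (z i).2 - (z j).2 with hw
  set m : EuclideanSpace ℝ d := lambertDir n ξ with hm
  have hvi : (y i).2 = c + (‖w‖ / 2) • m := by
    rw [hy, lambertPair_apply_left hij, hsep]; simp [hS, hc, hw, hm]
  have hvj : (y j).2 = c - (‖w‖ / 2) • m := by
    rw [hy, lambertPair_apply_right, hsep]; simp [hS, hc, hw, hm]
  have hdiff : (y i).2 - (y j).2 = ‖w‖ • m := by
    rw [hvi, hvj, add_sub_sub_cancel, ← add_smul, add_halves]
  -- the reflected velocities
  set X := collidePair (Torus.geometry d) i j y with hX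
  have hb : b = (2 : ℝ)⁻¹ • (w - ‖w‖ • (m - (2 * ⟪m, n⟫_ℝ / ‖n‖ ^ 2) • n)) := rfl
  have hXi : (X i).2 = (z i).2 - b := by
    rw [hX, collidePair_apply_left hij, hsep', reflectVel]
    dsimp only
    rw [hdiff, hvi, hb, hc, inner_smul_left]
    simp only [RCLike.conj_to_real, smul_sub, smul_smul]
    module
  have hXj : (X j).2 = (z j).2 + b := by
    rw [hX, collidePair_apply_right, hsep', reflectVel]
    dsimp only
    rw [hdiff, hvj, hb, hc, inner_smul_left]
    simp only [RCLike.conj_to_real, smul_sub, smul_smul]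
    module
  have hXi1 : (X i).1 = (z i).1 + Literature.Analysis.FunctionSpaces.Torus.proj (τ₀ • (z i).2) := by
    rw [hX, collidePair_apply_fst, hyi, hS, freeFlight_apply]; rfl
  have hXj1 : (X j).1 = (z j).1 + Literature.Analysis.FunctionSpaces.Torus.proj (τ₀ • (z j).2) := by
    rw [hX, collidePair_apply_fst, hyj, hS, freeFlight_apply]; rfl
  constructor
  · rw [freeFlight_apply, hXi, hXi1]
    refine Prod.ext ?_ rfl
    simp only [Torus.geometry_translate]
    rw [add_assoc, ← Literature.Analysis.FunctionSpaces.Torus.proj_add]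
    congr 2
    module
  · rw [freeFlight_apply, hXj, hXj1]
    refine Prod.ext ?_ rfl
    simp only [Torus.geometry_translate]
    rw [add_assoc, ← Literature.Analysis.FunctionSpaces.Torus.proj_add, sub_eq_add_neg, ← Literature.Analysis.FunctionSpaces.Torus.proj_neg]
    congr 2
    module

end JMap

end LWindow

end Summit.AtomisticToContinuum.HydrodynamicLimit.Theorems
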